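import Mathlib
import HarnessLib

/-!
# Exact unimodality certificates for the decay rate of Lai's box forms (`κ₃` ladder, J = 76 / 74 / 72)

HONEST FRAMING: systematic search; no irrationality claim unless certified. Pub cell `pub-zeta5`, lane
fam-indep (`families/indep/FAMILY.md` §5.13, note `families/indep/DECAY-L1.md` §2). Nothing in this file is an
irrationality or independence statement; it proves, for three explicit parameter points, that Lai's balance
equation has EXACTLY ONE positive real root.

Setting [Lai2024BallRivoal, §13, p.49]. For Lai's box form with `J` unit blocks and parameters `(r, M, δ₁…δ_J)`,
the decay constant `α̃` is evaluated at `x₀`, 'the unique positive real root of the polynomial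
`(2r+M+X)(r+X)∏_j(r+δ_j+X) − X(r+M+X)∏_j(r+M−δ_j+X)`' (uniqueness asserted there without proof for Table 2's
parameters). On the sum side (DECAY-L1.md Prop. 2.4) the critical points of the one-variable Stirling profile of
`S̃_n = Σ_ν R̃_n(ν)` are exactly these positive roots, so UNIQUENESS of the positive root is what makes
`lim (1/n) log S̃_n = −α̃(x₀)` a theorem at fixed parameters. This file supplies that uniqueness, kernel-checked,
at Lai's Table 2 point (J = 76, r = 2444, M = 444), at the cell's J = 74 point (r = 2180) and J = 72 point
(r = 2240) of FAMILY.md §5.10: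

* `linProdCoeffs cs` — exact little-endian coefficients of `∏_{c ∈ cs} (c + X)` over `ℕ`, with
  `evalL_linProdCoeffs : evalL (linProdCoeffs cs) X = (cs.map (· + X)).prod`;
* `domCheck a b` — the certificate `b₀ < a₀`, `a₁ < b₁`, `a_k ≤ b_k (k ≥ 1)` on two coefficient lists, decided by
  `decide +kernel` (integers of ≤ 260 digits; ~2 s);
* `existsUnique_pos_root_of_domCheck` — the certificate implies `∃! X > 0, evalL a X = evalL b X`
  (the difference is `(a₀ − b₀) − X·D(X)` with `D ≥ 1` non-decreasing on `[0,∞)`: strictly decreasing, IVT);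
* `laiBalance76_existsUnique_pos_root`, `laiBalance74_existsUnique_pos_root`, `laiBalance72_existsUnique_pos_root`.

The analytic half (Stirling profile, Laplace principle, `α̃ ≡` critical value) is NOT formalised here
(DECAY-L1.md §2, manuscript level).
-/

namespace Summit.KontsevichZagierPeriods.Zeta5Search

namespace LaiBoxUnimodal

open _root_.Filter _root_.Topology

/-! ### Exact coefficient arithmetic on little-endian lists over `ℕ` -/

/-- Coefficientwise sum of two little-endian coefficient lists (the shorter one padded with zeros). -/
def addL : List ℕ → List ℕ → List ℕ
  | [], q => q
  | a :: p, [] => a :: p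
  | a :: p, b :: q => (a + b) :: addL p q

/-- `(c + X) · p` on little-endian coefficient lists. -/
def mulLin (c : ℕ) (p : List ℕ) : List ℕ := addL (p.map (c * ·)) (0 :: p)

/-- Little-endian coefficients of `∏_{c ∈ cs} (c + X)`. -/
def linProdCoeffs : List ℕ → List ℕ
  | [] => [1]
  | c :: cs => mulLin c (linProdCoeffs cs)

/-- Horner evaluation of a little-endian coefficient list at a real point. -/
def evalL : List ℕ → ℝ → ℝ
  | [], _ => 0
  | a :: p, x => (a : ℝ) + x * evalL p x

/-- `evalL` of the padded sum is the sum. -/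
theorem evalL_addL (p q : List ℕ) (x : ℝ) : evalL (addL p q) x = evalL p x + evalL q x := by
  induction p generalizing q with
  | nil => simp [addL, evalL]
  | cons a p ih =>
    cases q with
    | nil => simp [addL, evalL]
    | cons b q => simp only [addL, evalL, ih, Nat.cast_add]; ring

/-- `evalL` of a scalar multiple. -/
theorem evalL_map_mul (c : ℕ) (p : List ℕ) (x : ℝ) : evalL (p.map (c * ·)) x = (c : ℝ) * evalL p x := by
  induction p with
  | nil => simp [evalL]
  | cons a p ih => simp only [List.map_cons, evalL, ih, Nat.cast_mul]; ring

/-- `evalL (mulLin c p) X = (c + X) · evalL p X`. -/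
theorem evalL_mulLin (c : ℕ) (p : List ℕ) (x : ℝ) : evalL (mulLin c p) x = ((c : ℝ) + x) * evalL p x := by
  simp only [mulLin, evalL_addL, evalL_map_mul, evalL, Nat.cast_zero, zero_add]; ring

/-- **Correctness of the coefficient computation**: `evalL (linProdCoeffs cs) X = ∏_{c ∈ cs} (c + X)`. -/
theorem evalL_linProdCoeffs (cs : List ℕ) (x : ℝ) :
    evalL (linProdCoeffs cs) x = (cs.map (fun c : ℕ => (c : ℝ) + x)).prod := by
  induction cs with
  | nil => simp [linProdCoeffs, evalL]
  | cons c cs ih => simp only [linProdCoeffs, evalL_mulLin, ih, List.map_cons, List.prod_cons]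

/-- `evalL p` is continuous. -/
theorem continuous_evalL (p : List ℕ) : Continuous (evalL p) := by
  induction p with
  | nil => simpa [evalL] using continuous_const
  | cons a p ih =>
    show Continuous (fun x => (a : ℝ) + x * evalL p x)
    exact continuous_const.add (continuous_id.mul ih)

/-! ### The certificate and what it implies -/

/-- `tailDom p q = true` iff the lists have the same length and `p_k ≤ q_k` termwise. -/
def tailDom : List ℕ → List ℕ → Bool
  | [], [] => true
  | a :: p, b :: q => decide (a ≤ b) && tailDom p q
  | _, _ => false

/-- The unimodality certificate on two coefficient lists `a` (for `L`) and `b` (for `R`):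
`b₀ < a₀`, `a₁ < b₁`, and `a_k ≤ b_k` for every `k ≥ 1` (same length). -/
def domCheck : List ℕ → List ℕ → Bool
  | a :: (a1 :: p), b :: (b1 :: q) => decide (b < a) && decide (a1 < b1) && tailDom (a1 :: p) (b1 :: q)
  | _, _ => false

/-- Under `tailDom p q`, the difference `D = evalL q − evalL p` is non-negative and non-decreasing on `[0,∞)`. -/
theorem tailDom_nonneg_mono {p q : List ℕ} (h : tailDom p q = true) :
    (∀ x : ℝ, 0 ≤ x → 0 ≤ evalL q x - evalL p x) ∧
    (∀ x y : ℝ, 0 ≤ x → x ≤ y → evalL q x - evalL p x ≤ evalL q y - evalL p y) := by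
  induction p generalizing q with
  | nil =>
    cases q with
    | nil => simp [evalL]
    | cons b q => simp [tailDom] at h
  | cons a p ih =>
    cases q with
    | nil => simp [tailDom] at h
    | cons b q =>
      simp only [tailDom, Bool.and_eq_true, decide_eq_true_eq] at h
      obtain ⟨hab, hpq⟩ := h
      obtain ⟨h0, hmono⟩ := ih hpq
      have hab' : (a : ℝ) ≤ b := by exact_mod_cast hab
      refine ⟨fun x hx => ?_, fun x y hx hxy => ?_⟩
      · simp only [evalL]
        have := h0 x hx
        nlinarith [mul_nonneg hx this]
      · simp only [evalL]
        have hDx := h0 x hx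
        have hDy := h0 y (hx.trans hxy)
        have hm := hmono x y hx hxy
        -- x·D(x) ≤ y·D(y)
        have : x * (evalL q x - evalL p x) ≤ y * (evalL q y - evalL p y) :=
          calc x * (evalL q x - evalL p x) ≤ x * (evalL q y - evalL p y) :=
                mul_le_mul_of_nonneg_left hm hx
            _ ≤ y * (evalL q y - evalL p y) := mul_le_mul_of_nonneg_right hxy hDy
        nlinarith [this]

/-- Under `tailDom (a₁ :: p) (b₁ :: q)` with `a₁ < b₁`, the difference is at least `1` on `[0,∞)`. -/
theorem one_le_diff_of_tailDom {a1 b1 : ℕ} {p q : List ℕ} (h : tailDom (a1 :: p) (b1 :: q) = true)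
    (h1 : a1 < b1) (x : ℝ) (hx : 0 ≤ x) :
    1 ≤ evalL (b1 :: q) x - evalL (a1 :: p) x := by
  simp only [tailDom, Bool.and_eq_true, decide_eq_true_eq] at h
  have h0 := (tailDom_nonneg_mono h.2).1 x hx
  have h1' : (a1 : ℝ) + 1 ≤ b1 := by exact_mod_cast h1
  simp only [evalL]
  nlinarith [mul_nonneg hx h0]

/-- **The certificate implies a unique positive root.** If `domCheck a b = true` then the real function
`X ↦ evalL a X − evalL b X` is positive at `0`, strictly decreasing on `[0,∞)` and eventually negative, hence
has exactly one positive zero. -/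
theorem existsUnique_pos_root_of_domCheck {a b : List ℕ} (h : domCheck a b = true) :
    ∃! X : ℝ, 0 < X ∧ evalL a X = evalL b X := by
  match a, b, h with
  | a0 :: a1 :: p, b0 :: b1 :: q, h =>
    simp only [domCheck, Bool.and_eq_true, decide_eq_true_eq] at h
    obtain ⟨⟨hba, h1⟩, ht⟩ := h
    -- notation
    set D : ℝ → ℝ := fun x => evalL (b1 :: q) x - evalL (a1 :: p) x with hD
    have hD1 : ∀ x : ℝ, 0 ≤ x → 1 ≤ D x := fun x hx => one_le_diff_of_tailDom ht h1 x hx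
    have hDm : ∀ x y : ℝ, 0 ≤ x → x ≤ y → D x ≤ D y := (tailDom_nonneg_mono ht).2
    -- g x = (a0 - b0) - x * D x
    have hg : ∀ x : ℝ, evalL (a0 :: a1 :: p) x - evalL (b0 :: b1 :: q) x = ((a0 : ℝ) - b0) - x * D x := by
      intro x; simp only [hD, evalL]; ring
    have hba' : (b0 : ℝ) + 1 ≤ a0 := by exact_mod_cast hba
    -- strict decrease on [0, ∞)
    have hstrict : ∀ x y : ℝ, 0 ≤ x → x < y →
        evalL (a0 :: a1 :: p) y - evalL (b0 :: b1 :: q) y < evalL (a0 :: a1 :: p) x - evalL (b0 :: b1 :: q) x := by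
      intro x y hx hxy
      rw [hg, hg]
      have hy : 0 ≤ y := hx.trans hxy.le
      have h2 : x * D x ≤ x * D y := mul_le_mul_of_nonneg_left (hDm x y hx hxy.le) hx
      have h3 : x * D y < y * D y := mul_lt_mul_of_pos_right hxy (by linarith [hD1 y hy])
      linarith
    -- existence by IVT on [0, X1], X1 = a0 - b0 (≥ 1)
    set X1 : ℝ := (a0 : ℝ) - b0 with hX1
    have hX1pos : 0 < X1 := by rw [hX1]; linarith
    have hcont : Continuous fun x => evalL (a0 :: a1 :: p) x - evalL (b0 :: b1 :: q) x :=
      (continuous_evalL _).sub (continuous_evalL _)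
    have hg0 : 0 < evalL (a0 :: a1 :: p) 0 - evalL (b0 :: b1 :: q) 0 := by
      rw [hg]; simp; linarith
    have hgX1 : evalL (a0 :: a1 :: p) X1 - evalL (b0 :: b1 :: q) X1 ≤ 0 := by
      rw [hg]
      have := hD1 X1 hX1pos.le
      nlinarith
    obtain ⟨X, hXmem, hXroot⟩ : ∃ X ∈ Set.Icc (0 : ℝ) X1,
        evalL (a0 :: a1 :: p) X - evalL (b0 :: b1 :: q) X = 0 := by
      have hsub := intermediate_value_Icc' hX1pos.le hcont.continuousOn
      have h0mem : (0 : ℝ) ∈ Set.Icc (evalL (a0 :: a1 :: p) X1 - evalL (b0 :: b1 :: q) X1)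
          (evalL (a0 :: a1 :: p) 0 - evalL (b0 :: b1 :: q) 0) := ⟨hgX1, hg0.le⟩
      exact hsub h0mem
    have hXpos : 0 < X := by
      rcases hXmem.1.eq_or_lt with h | h
      · exfalso; rw [← h] at hXroot; linarith
      · exact h
    refine ⟨X, ⟨hXpos, sub_eq_zero.mp hXroot⟩, ?_⟩
    rintro Y ⟨hYpos, hYroot⟩
    by_contra hne
    rcases lt_or_gt_of_ne hne with hlt | hgt
    · have := hstrict Y X hYpos.le hlt
      rw [hXroot, sub_eq_zero.mpr hYroot] at this; exact lt_irrefl _ this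
    · have := hstrict X Y hXpos.le hgt
      rw [hXroot, sub_eq_zero.mpr hYroot] at this; exact lt_irrefl _ this

/-- Packaging: from a kernel-checked `domCheck` on the coefficient lists of `∏_{c∈A}(c+X)` and `∏_{c∈B}(c+X)`
to the unique positive solution of `∏_{c∈A}(c+X) = ∏_{c∈B}(c+X)`. -/
theorem existsUnique_pos_root_linProd {A B : List ℕ}
    (h : domCheck (linProdCoeffs A) (linProdCoeffs B) = true) :
    ∃! X : ℝ, 0 < X ∧ (A.map (fun c : ℕ => (c : ℝ) + X)).prod = (B.map (fun c : ℕ => (c : ℝ) + X)).prod := by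
  simpa only [evalL_linProdCoeffs] using existsUnique_pos_root_of_domCheck h

/-! ### The three ladder points (FAMILY.md §5.10 / §5.13) -/

/-- Lai's Table 2 shifts `δ₁,…,δ₇₆` [Lai2024BallRivoal, §13 Table 2]. -/
def delta76 : List ℕ := [1,1,1,1,1,2,2,3,3,4,4,5,6,7,8,9,10,11,12,13,14,15,16,17,18,19,20,21,22,23,24,
  26,28,30,32,34,36,38,40,42,44,46,48,50,52,54,56,58,60,62,64,66,68,70,72,74,76,78,80,82,84,86,88,90,92,94,96,98,100,
  102,104,108,112,116,120,124]

/-- The cell's J = 74 profile (FAMILY.md §5.10 'best logged at J = 74', r = 2180, M = 444). -/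
def delta74 : List ℕ := [5,5,5,5,5,5,5,5,5,6,6,7,7,8,9,10,11,12,13,14,15,16,17,18,19,20,21,22,23,24,
  26,28,30,32,34,36,38,40,42,44,46,48,50,52,54,56,58,60,62,64,66,68,70,72,74,76,78,80,82,84,86,88,90,92,94,96,98,100,
  102,104,106,110,115,119]

/-- The cell's J = 72 profile (FAMILY.md §5.10 'best logged at J = 72', r = 2240, M = 444). -/
def delta72 : List ℕ := [5,5,5,5,5,5,5,5,5,6,6,7,7,8,9,10,11,12,13,14,15,16,17,18,19,20,21,22,23,24,
  26,28,30,32,34,36,38,40,42,44,46,48,50,52,54,56,58,60,62,64,66,68,70,72,74,76,78,80,82,84,86,88,90,92,94,96,98,100,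
  102,104,106,110]

/-- The linear-factor constants of Lai's `L(X) = (2r+M+X)(r+X)∏_j(r+δ_j+X)`. -/
def laiA (r M : ℕ) (δ : List ℕ) : List ℕ := (2 * r + M) :: r :: δ.map (r + ·)

/-- The linear-factor constants of Lai's `R(X) = X(r+M+X)∏_j(r+M−δ_j+X)` (the factor `X` is `0 + X`). -/
def laiB (r M : ℕ) (δ : List ℕ) : List ℕ := 0 :: (r + M) :: δ.map (fun d => r + M - d)

/-- Certificate at Lai's Table 2 point (J = 76, r = 2444, M = 444), by kernel evaluation. -/
theorem domCheck76 : domCheck (linProdCoeffs (laiA 2444 444 delta76)) (linProdCoeffs (laiB 2444 444 delta76)) = true := by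
  decide +kernel

/-- Certificate at the cell's J = 74 point (r = 2180, M = 444), by kernel evaluation. -/
theorem domCheck74 : domCheck (linProdCoeffs (laiA 2180 444 delta74)) (linProdCoeffs (laiB 2180 444 delta74)) = true := by
  decide +kernel

/-- Certificate at the cell's J = 72 point (r = 2240, M = 444), by kernel evaluation. -/
theorem domCheck72 : domCheck (linProdCoeffs (laiA 2240 444 delta72)) (linProdCoeffs (laiB 2240 444 delta72)) = true := by
  decide +kernel

/-- **Lai's Table 2 point: the balance equation `(2r+M+X)(r+X)∏(r+δ_j+X) = X(r+M+X)∏(r+M−δ_j+X)` has exactly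
one positive real root** (r = 2444, M = 444, δ = Table 2) — the uniqueness asserted on p.49 of
[Lai2024BallRivoal], now kernel-checked. -/
theorem laiBalance76_existsUnique_pos_root :
    ∃! X : ℝ, 0 < X ∧ ((laiA 2444 444 delta76).map (fun c : ℕ => (c : ℝ) + X)).prod =
      ((laiB 2444 444 delta76).map (fun c : ℕ => (c : ℝ) + X)).prod :=
  existsUnique_pos_root_linProd domCheck76

/-- **The cell's J = 74 point (r = 2180, M = 444): exactly one positive real root of the balance equation.** -/
theorem laiBalance74_existsUnique_pos_root :
    ∃! X : ℝ, 0 < X ∧ ((laiA 2180 444 delta74).map (fun c : ℕ => (c : ℝ) + X)).prod =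
      ((laiB 2180 444 delta74).map (fun c : ℕ => (c : ℝ) + X)).prod :=
  existsUnique_pos_root_linProd domCheck74

/-- **The cell's J = 72 point (r = 2240, M = 444): exactly one positive real root of the balance equation.** -/
theorem laiBalance72_existsUnique_pos_root :
    ∃! X : ℝ, 0 < X ∧ ((laiA 2240 444 delta72).map (fun c : ℕ => (c : ℝ) + X)).prod =
      ((laiB 2240 444 delta72).map (fun c : ℕ => (c : ℝ) + X)).prod :=
  existsUnique_pos_root_linProd domCheck72

end LaiBoxUnimodal

end Summit.KontsevichZagierPeriods.Zeta5Search
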